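import Literature.NumberTheory.Transcendental.KZCubeRational
import Literature.NumberTheory.Transcendental.KZProductIdeal
import Literature.NumberTheory.Transcendental.KZLogCalculusProofs
import Literature.NumberTheory.Transcendental.KZGroundingRelations
import HarnessLib

/-!
# Regular rational functions on the closed unit cube: the moves

Theorem-only companion of `KZCubeRational.lean` (vocabulary `KZ.RFun`).  For regular rational
functions on `[0,1]^M` every hypothesis of the cubical moves of the Kontsevich–Zagier calculus is
automatic, and this file packages them with NO side conditions left to the user:

* `RFun.rel_of_eqOn`, `rel_add`, `rel_neg`, `rel_sub`, `rel_sum`, `rel_of_eqOn_zero` — rule (1)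
  [Kontsevich–Zagier 2001, §1.2];
* `RFun.stokes`, `RFun.stokesAt i` — **Ayoub's relation** `[∂ᵢT] ≡ [T|_{xᵢ=1}] − [T|_{xᵢ=0}]`
  [Ayoub 2014, Def. 10], an instance of rule (3) (`KZ.cubicalStokesGens ⊆ KZ.relations` of
  `KZCubicalCalculus.lean`), derivative by the quotient rule, faces by substitution;
* `RFun.rel_rename` (coordinate permutations, rule (2) with `|det| = 1`,
  `KZ.of_sub_of_reindex_mem_relations`), `RFun.rel_lift` / `rel_liftN` (ignoring variables: Stokes
  with primitive `x_last · T`), `RFun.rel_tensor` (`[T]·[S] ≡ [T ⊗ S]`, the Fubini product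
  `KZ.of_mul_of` [Kontsevich–Zagier 2001, §4.1]);
* the same rules for the values `RFun.chi χ T = χ[T]` under an additive `χ` killing
  `KZ.relations` (`RFun.chi_add`, `chi_stokesAt`, `chi_rename`, `chi_liftN`, …) and, for a
  multiplicative `χ`, `RFun.chi_tensor : ⟪T ⊗ S⟫ = ⟪T⟫⟪S⟫`.

## References

* M. Kontsevich, D. Zagier, *Periods* (2001), §1.2, §4.1. [cite: KontsevichZagier2001, §1.2]
* J. Ayoub, *Periods and the conjectures of Grothendieck and Kontsevich–Zagier*, EMS Newsletter 91
  (2014), §2.2, Def. 10. [cite: Ayoub2014, Def. 10]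
-/

noncomputable section

open _root_.MeasureTheory _root_.Set MvPolynomial
open Literature.ModelTheory.ExponentialFields (IsSemialgebraic)

namespace Literature.NumberTheory.Transcendental.KZ

variable {M N : ℕ}

namespace RFun

variable {T S : RFun M}

/-! ### Relations -/

/-- **Congruence**: regular rational functions equal on the cube have equivalent representations.
[cite: KontsevichZagier2001, §1.2 rule (1)] -/
theorem rel_of_eqOn (h : ∀ x ∈ KZ.cube M, T.fn x = S.fn x) : KZ.of T.rep - KZ.of S.rep ∈ KZ.relations :=
  KZ.of_sub_of_mem_relations_of_eqOn rfl fun x hx => h x hx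

/-- **Additivity**: `[T + S] ≡ [T] + [S]`. [cite: KontsevichZagier2001, §1.2 rule (1)] -/
theorem rel_add (T S : RFun M) : KZ.of (T.add S).rep - KZ.of T.rep - KZ.of S.rep ∈ KZ.relations :=
  KZ.cubicalLinGens_subset_relations (KZ.mem_cubicalLinGens (T.add S).isTameCube_rep T.isTameCube_rep
    S.isTameCube_rep fun x hx => by simpa using fn_add hx)

/-- **Negation**: `[−T] ≡ −[T]`. [cite: KontsevichZagier2001, §1.2 rule (1)] -/
theorem rel_neg (T : RFun M) : KZ.of T.neg.rep + KZ.of T.rep ∈ KZ.relations := by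
  have h := KZ.of_add_of_mem_relations_of_eqOn_neg (r := T.rep) (r' := T.neg.rep) rfl fun x _ => by
    show T.neg.fn x = -T.fn x
    exact fn_neg x
  rwa [add_comm] at h

/-- **Subtraction**: `[T − S] ≡ [T] − [S]`. [cite: KontsevichZagier2001, §1.2 rule (1)] -/
theorem rel_sub (T S : RFun M) : KZ.of (T.sub S).rep - (KZ.of T.rep - KZ.of S.rep) ∈ KZ.relations := by
  have h1 := rel_add T S.neg
  have h2 := rel_neg S
  have : KZ.of (T.sub S).rep - (KZ.of T.rep - KZ.of S.rep) =
      (KZ.of (T.add S.neg).rep - KZ.of T.rep - KZ.of S.neg.rep) + (KZ.of S.neg.rep + KZ.of S.rep) := by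
    rw [sub]; abel
  rw [this]
  exact KZ.relations.add_mem h1 h2

/-- A regular rational function vanishing on the cube represents a relation. [cite: KontsevichZagier2001, §1.2 rule (1)] -/
theorem rel_of_eqOn_zero (h : ∀ x ∈ KZ.cube M, T.fn x = 0) : KZ.of T.rep ∈ KZ.relations :=
  KZ.of_mem_relations_of_eqOn_zero T.rep fun x hx => h x hx

/-- **Finite sums**: `[D, ∑ᵢ Tᵢ] ≡ ∑ᵢ [Tᵢ]` for a regular rational function with the summed values.
[cite: KontsevichZagier2001, §1.2 rule (1)] -/
theorem rel_sum {ι : Type*} (s : Finset ι) (T : ι → RFun M) (U : RFun M)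
    (h : ∀ x ∈ KZ.cube M, U.fn x = ∑ i ∈ s, (T i).fn x) :
    KZ.of U.rep - ∑ i ∈ s, KZ.of (T i).rep ∈ KZ.relations :=
  KZ.of_sub_sum_integrand_mem_relations s (fun i => (T i).rep) U.rep (fun _ _ => rfl) fun x hx => h x hx

/-- Value of the derivative along the last coordinate on the cube. [folklore] -/
theorem hasDerivAt_fn_snoc (T : RFun (M + 1)) {x : Fin M → ℝ} (hx : x ∈ KZ.cube M) {t : ℝ}
    (ht : t ∈ Icc (0 : ℝ) 1) :
    HasDerivAt (fun s : ℝ => T.fn (Fin.snoc x s)) (T.dlast.fn (Fin.snoc x t)) t := by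
  have hz : (Fin.snoc x t : Fin (M + 1) → ℝ) ∈ KZ.cube (M + 1) := KZ.snoc_mem_cube_iff.2 ⟨hx, ht.1, ht.2⟩
  have hQ : aeval (Function.update (Fin.snoc x t : Fin (M + 1) → ℝ) (Fin.last M) t) T.den ≠ 0 := by
    rw [Fin.update_snoc_last]; exact T.den_ne _ hz
  have h := hasDerivAt_aeval_div_aeval_update T.num T.den (Fin.snoc x t) (Fin.last M) t hQ
  simp only [Fin.update_snoc_last] at h
  have hval : T.dlast.fn (Fin.snoc x t) =
      (aeval (Fin.snoc x t : Fin (M + 1) → ℝ) (pderiv (Fin.last M) T.num) * aeval (Fin.snoc x t : Fin (M + 1) → ℝ) T.den -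
          aeval (Fin.snoc x t : Fin (M + 1) → ℝ) T.num * aeval (Fin.snoc x t : Fin (M + 1) → ℝ) (pderiv (Fin.last M) T.den)) /
        aeval (Fin.snoc x t : Fin (M + 1) → ℝ) T.den ^ 2 := by
    simp only [fn, dlast, map_sub, map_mul, map_pow]
  rw [hval]
  exact h

/-- **The Stokes move**: `[∂_last T] ≡ [T(·,1)] − [T(·,0)]` on the cube — Ayoub's relation, an
instance of Kontsevich–Zagier's rule (3) along the last coordinate with fibre `[0,1]`.
[cite: Ayoub2014, Def. 10] -/
theorem stokes (T : RFun (M + 1)) :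
    KZ.of T.dlast.rep - (KZ.of (T.face 1 ⟨zero_le_one, le_rfl⟩).rep - KZ.of (T.face 0 ⟨le_rfl, zero_le_one⟩).rep) ∈
      KZ.relations := by
  set F1 := T.face 1 ⟨zero_le_one, le_rfl⟩ with hF1
  set F0 := T.face 0 ⟨le_rfl, zero_le_one⟩ with hF0
  have h1 : KZ.of T.dlast.rep - KZ.of (F1.sub F0).rep ∈ KZ.relations :=
    KZ.cubicalStokesGens_subset_relations (KZ.mem_cubicalStokesGens T.dlast.isTameCube_rep
      (F1.sub F0).isTameCube_rep T.analyticOnNhd_fn T.isSemialgebraicFunOn_fn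
      (fun x hx t ht => T.hasDerivAt_fn_snoc hx ht) fun x hx => by
        show (F1.sub F0).fn x = T.fn (Fin.snoc x 1) - T.fn (Fin.snoc x 0)
        rw [fn_sub hx, hF1, hF0, fn_face, fn_face]; push_cast; rfl)
  have h2 := rel_sub F1 F0
  have : KZ.of T.dlast.rep - (KZ.of F1.rep - KZ.of F0.rep) =
      (KZ.of T.dlast.rep - KZ.of (F1.sub F0).rep) + (KZ.of (F1.sub F0).rep - (KZ.of F1.rep - KZ.of F0.rep)) := by abel
  rw [this]
  exact KZ.relations.add_mem h1 h2

/-- **Relabelling the variables is a relation.** [cite: KontsevichZagier2001, §1.2 rule (2)] -/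
theorem rel_rename (T : RFun M) (e : Fin M ≃ Fin N) : KZ.of T.rep - KZ.of (T.rename e).rep ∈ KZ.relations := by
  have h1 := KZ.of_sub_of_reindex_mem_relations T.rep e
  have h2 : KZ.of (T.rep.reindex e) - KZ.of (T.rename e).rep ∈ KZ.relations := by
    refine KZ.of_sub_of_mem_relations_of_eqOn ?_ fun y _ => ?_
    · show KZ.cube N = {w | (fun i => w (e i)) ∈ KZ.cube M}
      ext w
      simp only [KZ.mem_cube, mem_setOf_eq]
      exact ⟨fun h i => h (e i), fun h j => by simpa using h (e.symm j)⟩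
    · show T.fn (fun i => y (e i)) = (T.rename e).fn y
      rw [fn_rename]; rfl
  have : KZ.of T.rep - KZ.of (T.rename e).rep =
      (KZ.of T.rep - KZ.of (T.rep.reindex e)) + (KZ.of (T.rep.reindex e) - KZ.of (T.rename e).rep) := by abel
  rw [this]
  exact KZ.relations.add_mem h1 h2

/-- **Ignoring a variable is a relation**: `[[0,1]^{M+1}, T ∘ init] ≡ [[0,1]^M, T]` (Stokes with the
primitive `x_{last} · T`). [cite: KontsevichZagier2001, §1.2 rule (3)] -/
theorem rel_lift (T : RFun M) : KZ.of T.lift.rep - KZ.of T.rep ∈ KZ.relations := by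
  -- `F := X_last · lift T`, `∂_last F = lift T`, `F(·,1) − F(·,0) = T`
  set F : RFun (M + 1) := (poly (X (Fin.last M))).mul T.lift with hF
  have hst := stokes F
  have e1 : KZ.of F.dlast.rep - KZ.of T.lift.rep ∈ KZ.relations := by
    refine rel_of_eqOn fun y hy => ?_
    -- compare the two derivatives of `s ↦ F (init y, s)` at `s = y last`
    have hy' : Fin.init y ∈ KZ.cube M := fun i => hy (Fin.castSucc i)
    have hlast : y (Fin.last M) ∈ Icc (0 : ℝ) 1 := ⟨(hy _).1, (hy _).2⟩
    have hd := F.hasDerivAt_fn_snoc hy' hlast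
    rw [Fin.snoc_init_self] at hd
    have hd' : HasDerivAt (fun s : ℝ => F.fn (Fin.snoc (Fin.init y) s)) (T.lift.fn y) (y (Fin.last M)) := by
      have hfun : (fun s : ℝ => F.fn (Fin.snoc (Fin.init y) s)) = fun s => s * T.fn (Fin.init y) := by
        funext s; rw [hF, fn_mul, fn_poly, aeval_X, Fin.snoc_last, fn_lift_snoc]
      rw [hfun, fn_lift]
      simpa using (hasDerivAt_id (y (Fin.last M))).mul_const (T.fn (Fin.init y))
    exact hd.unique hd'
  have e2 : KZ.of (F.face 1 ⟨zero_le_one, le_rfl⟩).rep - KZ.of T.rep ∈ KZ.relations :=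
    rel_of_eqOn fun x _ => by rw [fn_face, hF, fn_mul, fn_poly, aeval_X, Fin.snoc_last, fn_lift_snoc]; simp
  have e3 : KZ.of (F.face 0 ⟨le_rfl, zero_le_one⟩).rep ∈ KZ.relations :=
    rel_of_eqOn_zero fun x _ => by rw [fn_face, hF, fn_mul, fn_poly, aeval_X, Fin.snoc_last]; simp
  have : KZ.of T.lift.rep - KZ.of T.rep =
      (KZ.of F.dlast.rep - (KZ.of (F.face 1 ⟨zero_le_one, le_rfl⟩).rep - KZ.of (F.face 0 ⟨le_rfl, zero_le_one⟩).rep))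
      - (KZ.of F.dlast.rep - KZ.of T.lift.rep)
      + (KZ.of (F.face 1 ⟨zero_le_one, le_rfl⟩).rep - KZ.of T.rep)
      - KZ.of (F.face 0 ⟨le_rfl, zero_le_one⟩).rep := by abel
  rw [this]
  exact KZ.relations.sub_mem (KZ.relations.add_mem (KZ.relations.sub_mem hst e1) e2) e3

/-- **The Fubini product of two cube representations is the cube representation of the tensor
product.** [cite: KontsevichZagier2001, §4.1] -/
theorem rel_tensor (T : RFun M) (S : RFun N) :
    KZ.of T.rep * KZ.of S.rep - KZ.of (T.tensor S).rep ∈ KZ.relations := by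
  rw [KZ.of_mul_of]
  have hsa : IsSemialgebraicFunOn ℚ (KZ.IntegralRep.prodDomain T.rep S.rep) (KZ.IntegralRep.prodFun T.rep S.rep) := by
    have hdom : KZ.IntegralRep.prodDomain T.rep S.rep = KZ.cube (M + N) := by
      ext z
      simp only [KZ.IntegralRep.mem_prodDomain, rep_domain, KZ.mem_cube]
      constructor
      · rintro ⟨h1, h2⟩ k
        induction k using Fin.addCases with
        | left i => exact h1 i
        | right j => exact h2 j
      · intro h; exact ⟨fun i => h _, fun j => h _⟩
    rw [hdom]
    refine (T.tensor S).isSemialgebraicFunOn_fn.congr fun z _ => ?_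
    rw [KZ.IntegralRep.prodFun_apply, fn_tensor]; rfl
  refine KZ.of_sub_of_mem_relations_of_eqOn ?_ fun z hz => ?_
  · show KZ.cube (M + N) = KZ.IntegralRep.prodDomain T.rep S.rep
    ext z
    simp only [KZ.IntegralRep.mem_prodDomain, rep_domain, KZ.mem_cube]
    constructor
    · intro h; exact ⟨fun i => h _, fun j => h _⟩
    · rintro ⟨h1, h2⟩ k
      induction k using Fin.addCases with
      | left i => exact h1 i
      | right j => exact h2 j
  · rw [KZ.IntegralRep.prod_integrand_of _ _ hsa, KZ.IntegralRep.prodFun_apply]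
    show T.fn _ * S.fn _ = (T.tensor S).fn z
    rw [fn_tensor]


/-- **The Stokes move along any coordinate**: `[∂ᵢ T] ≡ [T|_{xᵢ=1}] − [T|_{xᵢ=0}]`.
[cite: Ayoub2014, Def. 10] -/
theorem stokesAt (i : Fin (M + 1)) (T : RFun (M + 1)) :
    KZ.of (T.pd i).rep - (KZ.of (T.faceAt i 1 ⟨zero_le_one, le_rfl⟩).rep - KZ.of (T.faceAt i 0 ⟨le_rfl, zero_le_one⟩).rep) ∈
      KZ.relations := by
  have h1 := rel_rename (T.pd i) (toLast i)
  have h2 := stokes (T.rename (toLast i))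
  have heq : (T.pd i).rename (toLast i) = (T.rename (toLast i)).dlast := by
    have hi : (toLast i) i = Fin.last M := toLast_self i
    simp only [rename, pd, dlast, map_sub, map_mul, map_pow, ← hi,
      pderiv_rename (toLast i).injective]
  rw [heq] at h1
  have : KZ.of (T.pd i).rep - (KZ.of (T.faceAt i 1 ⟨zero_le_one, le_rfl⟩).rep - KZ.of (T.faceAt i 0 ⟨le_rfl, zero_le_one⟩).rep) =
      (KZ.of (T.pd i).rep - KZ.of (T.rename (toLast i)).dlast.rep) +
      (KZ.of (T.rename (toLast i)).dlast.rep -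
        (KZ.of ((T.rename (toLast i)).face 1 ⟨zero_le_one, le_rfl⟩).rep - KZ.of ((T.rename (toLast i)).face 0 ⟨le_rfl, zero_le_one⟩).rep)) := by
    simp only [faceAt]; abel
  rw [this]
  exact KZ.relations.add_mem h1 h2

/-- **Ignoring `n` variables is a relation.** [cite: KontsevichZagier2001, §1.2 rule (3)] -/
theorem rel_liftN (T : RFun M) : ∀ n : ℕ, KZ.of (T.liftN n).rep - KZ.of T.rep ∈ KZ.relations
  | 0 => rel_of_eqOn fun z _ => fn_liftN_zero T z
  | n + 1 => by
    rw [liftN_succ]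
    have : KZ.of (T.liftN n).lift.rep - KZ.of T.rep =
        (KZ.of (T.liftN n).lift.rep - KZ.of (T.liftN n).rep) + (KZ.of (T.liftN n).rep - KZ.of T.rep) := by abel
    rw [this]
    exact KZ.relations.add_mem (rel_lift _) (rel_liftN T n)

end RFun

/-! ## Rules for the `χ`-values -/

section Chi

variable {R : Type} [CommRing R] {χ : KZ.FormalRep →+ R}
variable (hrel : ∀ c ∈ KZ.relations, χ c = 0)
include hrel

/-- Equal on the cube ⇒ equal `χ`-values. [folklore] -/
theorem RFun.chi_congr {T S : RFun M} (h : ∀ x ∈ KZ.cube M, T.fn x = S.fn x) : T.chi χ = S.chi χ :=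
  sub_eq_zero.1 (by rw [RFun.chi, RFun.chi, ← map_sub]; exact hrel _ (RFun.rel_of_eqOn h))

/-- `⟪T + S⟫ = ⟪T⟫ + ⟪S⟫`. [folklore] -/
theorem RFun.chi_add (T S : RFun M) : (T.add S).chi χ = T.chi χ + S.chi χ := by
  have h := hrel _ (RFun.rel_add T S)
  rw [map_sub, map_sub] at h
  simp only [RFun.chi]
  linear_combination h

/-- `⟪−T⟫ = −⟪T⟫`. [folklore] -/
theorem RFun.chi_neg (T : RFun M) : T.neg.chi χ = -T.chi χ := by
  have h := hrel _ (RFun.rel_neg T)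
  rw [map_add] at h
  simp only [RFun.chi]
  linear_combination h

/-- `⟪T − S⟫ = ⟪T⟫ − ⟪S⟫`. [folklore] -/
theorem RFun.chi_sub (T S : RFun M) : (T.sub S).chi χ = T.chi χ - S.chi χ := by
  rw [RFun.sub, RFun.chi_add hrel, RFun.chi_neg hrel, sub_eq_add_neg]

/-- Vanishing on the cube ⇒ zero `χ`-value. [folklore] -/
theorem RFun.chi_eq_zero {T : RFun M} (h : ∀ x ∈ KZ.cube M, T.fn x = 0) : T.chi χ = 0 :=
  hrel _ (RFun.rel_of_eqOn_zero h)

/-- `⟪U⟫ = ∑ᵢ ⟪Tᵢ⟫` when `U = ∑ᵢ Tᵢ` on the cube. [folklore] -/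
theorem RFun.chi_sum {ι : Type*} (s : Finset ι) (T : ι → RFun M) (U : RFun M)
    (h : ∀ x ∈ KZ.cube M, U.fn x = ∑ i ∈ s, (T i).fn x) : U.chi χ = ∑ i ∈ s, (T i).chi χ := by
  have h := hrel _ (RFun.rel_sum s T U h)
  rw [map_sub, map_sum] at h
  simp only [RFun.chi]
  exact sub_eq_zero.1 h

/-- **Stokes**: `⟪∂ᵢT⟫ = ⟪T|_{xᵢ=1}⟫ − ⟪T|_{xᵢ=0}⟫`. [cite: Ayoub2014, Def. 10] -/
theorem RFun.chi_stokesAt (i : Fin (M + 1)) (T : RFun (M + 1)) :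
    (T.pd i).chi χ = (T.faceAt i 1 ⟨zero_le_one, le_rfl⟩).chi χ - (T.faceAt i 0 ⟨le_rfl, zero_le_one⟩).chi χ := by
  have h := hrel _ (RFun.stokesAt i T)
  rw [map_sub, map_sub] at h
  simp only [RFun.chi]
  linear_combination h

/-- Relabelling invariance. [folklore] -/
theorem RFun.chi_rename (T : RFun M) (e : Fin M ≃ Fin N) : (T.rename e).chi χ = T.chi χ := by
  have h := hrel _ (RFun.rel_rename T e)
  rw [map_sub] at h
  simp only [RFun.chi]
  linear_combination -h

/-- Ignoring variables. [folklore] -/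
theorem RFun.chi_liftN (T : RFun M) (n : ℕ) : (T.liftN n).chi χ = T.chi χ := by
  have h := hrel _ (RFun.rel_liftN T n)
  rw [map_sub] at h
  simp only [RFun.chi]
  linear_combination h

variable (hmul : ∀ x y : KZ.FormalRep, χ (x * y) = χ x * χ y)
include hmul

/-- **Fubini**: `⟪T ⊗ S⟫ = ⟪T⟫ ⟪S⟫`. [cite: KontsevichZagier2001, §4.1] -/
theorem RFun.chi_tensor (T : RFun M) (S : RFun N) : (T.tensor S).chi χ = T.chi χ * S.chi χ := by
  have h := hrel _ (RFun.rel_tensor T S)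
  rw [map_sub, hmul] at h
  simp only [RFun.chi]
  linear_combination -h

end Chi

end Literature.NumberTheory.Transcendental.KZ
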